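import Summits.Ventures.DiscreteObjects.PP12.FanoFiveWordCheckerSound

/-!
# PP(12), order 5: first leaves of the kernel certificate (two quadruples of weight-2 words refuted by `decide +kernel`)
Framing: lottery ticket; floor = certified bounds/negative ranges.

Cell pub-namedobj (venture DiscreteObjects), target (M), designs gen 17. Proof of concept for the campaign behind `FanoFive.noOrderFive_of_checked`
(`FanoFiveWordCheckerSound`): the hypothesis `Cert.noCompl 9 ([0, 95, 63] ++ A) Cert.W4 = true` for the quadruples `A = [3, 5, 33, 65]` (79 DFS nodes)
and `A = [3, 5, 9, 33]` (239 nodes), the second one as a SPLIT certificate glued by `Cert.scan_of_seg` (the recipe a generator will follow for the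
`≈ 8·10⁵`-node campaign, HANDOFF item (c)). Kernel evaluation only (`decide +kernel`, default heartbeats); these are 2 of the 5985 quadruples
(34 orbits of admissible ones under `IsWordCode.perm`), so NOTHING about the order-5 cell follows from this file alone. No `sorry`, no new axioms.
-/

namespace Summit.Ventures.DiscreteObjects.PP12

namespace FanoFive

namespace Cert

/-- the quadruple `{3, 5, 33, 65}` of weight-2 words admits no completion to a word code (79-node search, evaluated by the kernel) -/
theorem noCompl_3_5_33_65 : noCompl 9 [0, 95, 63, 3, 5, 33, 65] W4 = true := by
  decide +kernel

/-- the quadruple `{3, 5, 9, 33}` admits no completion (239-node search), as a split certificate: candidates `W4[0..20)` and `W4[20..35)` separately -/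
theorem noCompl_3_5_9_33 : noCompl 9 [0, 95, 63, 3, 5, 9, 33] W4 = true := by
  apply noCompl_succ_of_scan
  have e : W4 = W4.take 20 ++ W4.drop 20 := (List.take_append_drop 20 W4).symm
  rw [e]
  exact scan_of_seg (by decide +kernel) (by decide +kernel)

end Cert

end FanoFive

end Summit.Ventures.DiscreteObjects.PP12
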